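import Summits.Ventures.HodgeRepro2.T5SU11ResolventIdentityDecay

/-!
# The resolvents of the radial Laplacian commute on the exponentially decaying class

For `λ, λ₂ > 1` and a source `g` of the exponentially decaying class at a rate `ε > max(2 − λ, 2 − λ₂)` (rows
496–500), the resolvent identity of row 500 read in both orders gives

* `mu_injOn`: the spectral parameter `μ(λ) = λ(λ − 2)` is injective on `λ > 1` (`λ(λ−2) − λ₂(λ₂−2) =
  (λ − λ₂)(λ + λ₂ − 2)`), so `μ ≠ μ₂` exactly when `λ ≠ λ₂` (`mu_sub_ne_zero`);
* **`greenSolI_comm`: `G^I_λ(G^I_{λ₂} g) = G^I_{λ₂}(G^I_λ g)` on `(0, ∞)`** — the two resolvents commute (for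
  `λ ≠ λ₂` by cancelling `μ − μ₂` between the two readings of row 500; for `λ = λ₂` there is nothing to prove);
* `greenSolI_comp_eq_div`: for `λ ≠ λ₂` the composition is the difference quotient
  `G^I_λ(G^I_{λ₂} g) = (G^I_λ g − G^I_{λ₂} g)/(μ − μ₂)`.

Nothing is claimed about (N).

Blind lane: Mathlib + the HodgeRepro2 prefix only; no sorry; axioms ⊆ {propext, Classical.choice,
Quot.sound}.
-/

namespace Summit.Ventures.HodgeRepro2.T5SU11ResolventCommute

open Filter Topology MeasureTheory
open Set (Ioi Ioc)
open T5SU11Cartan T5SU11SphericalFunction T5SU11SphericalDecay T5SU11RadialGreenImproper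
  T5SU11ResolventIdentityDecay

/-- `λ(λ−2) − λ₂(λ₂−2) = (λ − λ₂)(λ + λ₂ − 2)`. -/
theorem mu_sub_mu (lam lam₂ : ℝ) :
    lam * (lam - 2) - lam₂ * (lam₂ - 2) = (lam - lam₂) * (lam + lam₂ - 2) := by ring

/-- **The spectral parameter `μ(λ) = λ(λ−2)` is injective on `λ > 1`.** -/
theorem mu_injOn : Set.InjOn (fun lam : ℝ => lam * (lam - 2)) (Ioi 1) := by
  intro lam hlam lam₂ hlam₂ h
  have hlam' : (1 : ℝ) < lam := hlam
  have hlam₂' : (1 : ℝ) < lam₂ := hlam₂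
  have h0 : (lam - lam₂) * (lam + lam₂ - 2) = 0 := by
    rw [← mu_sub_mu]
    simp only at h
    linarith
  rcases mul_eq_zero.mp h0 with h1 | h1
  · linarith
  · linarith

/-- For `λ, λ₂ > 1`, `μ − μ₂ ≠ 0` iff `λ ≠ λ₂`. -/
theorem mu_sub_ne_zero {lam lam₂ : ℝ} (hlam : 1 < lam) (hlam₂ : 1 < lam₂) :
    lam * (lam - 2) - lam₂ * (lam₂ - 2) ≠ 0 ↔ lam ≠ lam₂ := by
  constructor
  · intro h heq
    exact h (by rw [heq]; ring)
  · intro h heq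
    exact h (mu_injOn hlam hlam₂ (by simpa using sub_eq_zero.mp heq))

section measure

variable [MeasurableSpace Circle] [BorelSpace Circle]

variable {lam lam₂ : ℝ} (hlam : 1 < lam) (hlam₂ : 1 < lam₂) {g : ℝ → ℝ} (hg : ContinuousOn g (Ioi 0))
  {M : ℝ} (hM : ∀ s ∈ Ioc (0 : ℝ) 1, |g s| ≤ M) (hM0 : 0 ≤ M)
  {ε C s₀ : ℝ} (hε : 2 - lam < ε) (hε₂ : 2 - lam₂ < ε) (hC : ∀ s, s₀ ≤ s → |g s| ≤ C * Real.exp (-ε * s))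

include hlam hlam₂ hg hM hM0 hε hε₂ hC in
/-- **THE RESOLVENTS COMMUTE ON THE EXPONENTIALLY DECAYING CLASS**:
`G^I_λ(G^I_{λ₂} g) = G^I_{λ₂}(G^I_λ g)` on `(0, ∞)`. -/
theorem greenSolI_comm {t : ℝ} (ht : 0 < t) :
    greenSolI (fun t => sph lam (hyp t)) (sphDecay lam) (greenSolI (fun t => sph lam₂ (hyp t)) (sphDecay lam₂) g) t
      = greenSolI (fun t => sph lam₂ (hyp t)) (sphDecay lam₂)
          (greenSolI (fun t => sph lam (hyp t)) (sphDecay lam) g) t := by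
  by_cases hne : lam = lam₂
  · subst hne
    rfl
  · have h1 := greenSolI_sub_greenSolI_eq hlam hlam₂ hg hM hM0 hε hε₂ hC ht
    have h2 := greenSolI_sub_greenSolI_eq hlam₂ hlam hg hM hM0 hε₂ hε hC ht
    have hκ : lam * (lam - 2) - lam₂ * (lam₂ - 2) ≠ 0 := (mu_sub_ne_zero hlam hlam₂).mpr hne
    apply mul_left_cancel₀ hκ
    linear_combination -h1 - h2

include hlam hlam₂ hg hM hM0 hε hε₂ hC in
/-- For `λ ≠ λ₂` the composition is the difference quotient of the resolvent:
`G^I_λ(G^I_{λ₂} g) = (G^I_λ g − G^I_{λ₂} g)/(μ − μ₂)` on `(0, ∞)`. -/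
theorem greenSolI_comp_eq_div (hne : lam ≠ lam₂) {t : ℝ} (ht : 0 < t) :
    greenSolI (fun t => sph lam (hyp t)) (sphDecay lam) (greenSolI (fun t => sph lam₂ (hyp t)) (sphDecay lam₂) g) t
      = (greenSolI (fun t => sph lam (hyp t)) (sphDecay lam) g t
          - greenSolI (fun t => sph lam₂ (hyp t)) (sphDecay lam₂) g t)
        / (lam * (lam - 2) - lam₂ * (lam₂ - 2)) := by
  have hκ : lam * (lam - 2) - lam₂ * (lam₂ - 2) ≠ 0 := (mu_sub_ne_zero hlam hlam₂).mpr hne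
  rw [eq_div_iff hκ, mul_comm]
  exact (greenSolI_sub_greenSolI_eq hlam hlam₂ hg hM hM0 hε hε₂ hC ht).symm

include hlam hlam₂ hg hM hM0 hε hε₂ hC in
/-- The composition is symmetric in `(λ, λ₂)` also in difference-quotient form:
`(G^I_λ g − G^I_{λ₂} g)/(μ − μ₂) = (G^I_{λ₂} g − G^I_λ g)/(μ₂ − μ)`. -/
theorem greenSolI_div_symm (hne : lam ≠ lam₂) {t : ℝ} (ht : 0 < t) :
    (greenSolI (fun t => sph lam (hyp t)) (sphDecay lam) g t
        - greenSolI (fun t => sph lam₂ (hyp t)) (sphDecay lam₂) g t)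
      / (lam * (lam - 2) - lam₂ * (lam₂ - 2))
      = (greenSolI (fun t => sph lam₂ (hyp t)) (sphDecay lam₂) g t
          - greenSolI (fun t => sph lam (hyp t)) (sphDecay lam) g t)
        / (lam₂ * (lam₂ - 2) - lam * (lam - 2)) := by
  rw [← greenSolI_comp_eq_div hlam hlam₂ hg hM hM0 hε hε₂ hC hne ht,
    ← greenSolI_comp_eq_div hlam₂ hlam hg hM hM0 hε₂ hε hC (Ne.symm hne) ht]
  exact greenSolI_comm hlam hlam₂ hg hM hM0 hε hε₂ hC ht

end measure

end Summit.Ventures.HodgeRepro2.T5SU11ResolventCommute
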